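import Summits.Ventures.DiscreteObjects.Hadamard.Order49Structure668
import Summits.Ventures.DiscreteObjects.Hadamard.InvolutionTools

/-!
# Hadamard 668 census, family F12 — two fixed rows against the fixed columns ('(E3) mod p' in the kernel), and an
# automorphism of order 49 of an H(668) fixes EXACTLY 10 rows and 10 columns (kernel, structure)

Framing: lottery ticket; floor = certified bounds/negative ranges.

Cell pub-namedobj (venture DiscreteObjects), target (H), hadamard gen 17.  `Order49Structure668` left `#Fix ∈ {3, 10}` for
the permutation parts of a signed automorphism `(π, κ, d, e)` of an H(668) of pair-order `49`, with the remark that the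
orbit identity (E3) removes `3` on paper.  Here (E3) is done in the kernel, in the generality 'one signed automorphism
whose column part has exponent `p²`':
* `dvd_sum_moved_sq`: for `σ^(p·p) = 1` (`p` prime) and a `σ`-invariant integer function `g`, `p ∣ Σ_{σ y ≠ y} g y`
  [split the moved points into those moved by `σ^p` (`dvd_sum_moved` for `σ^p`) and those fixed by `σ^p`, on which `σ`
  restricts to a permutation of exponent `p` (`dvd_sum_moved` on the subtype)];
* **`fixedRows_inner_dvd`**: for two `π`-fixed rows `x ≠ x'` with `d x = d x'` and `κ^(p·p) = 1`:
  `p ∣ Σ_{κ y = y} H x y · H x' y` [the rows are orthogonal and `y ↦ H x y · H x' y` is `κ`-invariant], while this sum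
  of `±1`'s has absolute value `≤ #Fix(κ)` and the parity of `#Fix(κ)` (`sum_pm_eq_card_sub_two_mul`);
* **`hadamard668_order49_fixed_ten`**: `π^49 = κ^49 = 1`, `(π^7, κ^7) ≠ (1,1)` ⇒ `#Fix(π) = #Fix(κ) = 10` (and
  `#Fix(π^7) = #Fix(κ^7) = 80`): `#Fix(κ) = 3` would make the sum `±1` or `±3`, not a multiple of `7` (two `π`-fixed
  rows exist since `#Fix(π) ≥ 3`, and all fixed rows carry the sign of a fixed column, `signedAut_fixed_sign`).
STRUCTURE only: order `49` is not excluded (the identities (E1)/(E2) of FAMILY-F12-G16 §3 are satisfiable with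
`d = d' = 10`, `k = k' = 10`, `c = c' = 12`).  Ours, not literature; no `sorry`.
-/

namespace Summit.Ventures.DiscreteObjects.Hadamard

open Finset BigOperators Matrix

open Literature.Combinatorics.Designs.GoethalsSeidel (IsHadamardMatrix)

variable {ι : Type*} [Fintype ι] [DecidableEq ι]

/-- **`p ∣ Σ_{moved} g`** for a `σ`-invariant `g` when `σ^(p·p) = 1`. -/
lemma dvd_sum_moved_sq (σ : Equiv.Perm ι) {p : ℕ} (hp : p.Prime) (hσ : σ ^ (p * p) = 1) (g : ι → ℤ)
    (hg : ∀ y, g (σ y) = g y) : (p : ℤ) ∣ ∑ y ∈ univ.filter (fun y => σ y ≠ y), g y := by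
  classical
  have hgpow : ∀ (k : ℕ) (y : ι), g ((σ ^ k) y) = g y := by
    intro k y; induction k with
    | zero => simp
    | succ k ih => rw [pow_succ', Equiv.Perm.mul_apply, hg, ih]
  -- split the moved points by whether σ^p fixes them
  have hAB : ∑ y ∈ univ.filter (fun y => σ y ≠ y), g y =
      (∑ y ∈ (univ.filter fun y => σ y ≠ y).filter (fun y => (σ ^ p) y = y), g y) +
      ∑ y ∈ (univ.filter fun y => σ y ≠ y).filter (fun y => ¬ (σ ^ p) y = y), g y :=
    (Finset.sum_filter_add_sum_filter_not _ _ _).symm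
  have hset1 : (univ.filter fun y => σ y ≠ y).filter (fun y => ¬ (σ ^ p) y = y) =
      univ.filter fun y => (σ ^ p) y ≠ y := by
    ext y; simp only [Finset.mem_filter, Finset.mem_univ, true_and]
    constructor
    · rintro ⟨-, h⟩; exact h
    · intro h; exact ⟨fun hy => h (perm_pow_apply_of_fixed σ hy p), h⟩
  have hset2 : (univ.filter fun y => σ y ≠ y).filter (fun y => (σ ^ p) y = y) =
      (univ.filter fun y => (σ ^ p) y = y).filter (fun y => σ y ≠ y) := by
    ext y; simp only [Finset.mem_filter, Finset.mem_univ, true_and]; exact And.comm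
  rw [hAB, hset1, hset2]
  apply dvd_add
  · -- on the points fixed by σ^p, σ restricts to a permutation of exponent p
    have hinv : ∀ y, (σ ^ p) y = y ↔ (σ ^ p) (σ y) = σ y := by
      intro y
      rw [pow_apply_comm σ p y]
      constructor
      · intro h; rw [h]
      · intro h; exact σ.injective h
    have hinv' : ∀ y, (σ ^ p) (σ y) = σ y ↔ (σ ^ p) y = y := fun y => (hinv y).symm
    set ρ : Equiv.Perm {y // (σ ^ p) y = y} := σ.subtypePerm hinv' with hρ
    have hρp : ρ ^ p = 1 := by
      ext ⟨y, hy⟩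
      have h1 : (((ρ ^ p) ⟨y, hy⟩ : {y // (σ ^ p) y = y}) : ι) = (σ ^ p) y := by
        rw [hρ, Equiv.Perm.subtypePerm_pow]; rfl
      rw [h1, hy]; rfl
    have hsub := dvd_sum_moved ρ hp hρp (fun z => g z.1) (fun z₀ _ i => by
      show g (((ρ ^ i) z₀ : {y // (σ ^ p) y = y}) : ι) = g z₀.1
      have : (((ρ ^ i) z₀ : {y // (σ ^ p) y = y}) : ι) = (σ ^ i) z₀.1 := by
        rw [hρ, Equiv.Perm.subtypePerm_pow]; rfl
      rw [this, hgpow])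
    rw [Finset.sum_filter,
      Finset.sum_subtype (univ.filter fun y => (σ ^ p) y = y) (p := fun y => (σ ^ p) y = y) (fun y => by simp),
      ← Finset.sum_filter]
    have e : (univ.filter fun z : {y // (σ ^ p) y = y} => σ z.1 ≠ z.1) = univ.filter fun z => ρ z ≠ z := by
      ext z
      simp only [Finset.mem_filter, Finset.mem_univ, true_and, hρ]
      rw [not_iff_not]
      constructor
      · intro h; exact Subtype.ext (by rw [Equiv.Perm.subtypePerm_apply]; exact h)
      · intro h; have := congrArg Subtype.val h; rw [Equiv.Perm.subtypePerm_apply] at this; exact this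
    rw [e]
    exact hsub
  · -- σ^p has exponent p and g is invariant under its powers
    have hτ : (σ ^ p) ^ p = 1 := by rw [← pow_mul]; exact hσ
    exact dvd_sum_moved (σ ^ p) hp hτ g (fun y₀ _ i => by rw [← pow_mul]; exact hgpow _ y₀)

omit [Fintype ι] [DecidableEq ι] in
/-- a sum of `±1` over a finite set is `|S| − 2m` for some `m ≤ |S|` -/
lemma sum_pm_eq_card_sub_two_mul (S : Finset ι) (g : ι → ℤ) (hg : ∀ y ∈ S, g y = 1 ∨ g y = -1) :
    ∃ m : ℕ, m ≤ S.card ∧ ∑ y ∈ S, g y = S.card - 2 * m := by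
  classical
  refine ⟨(S.filter fun y => g y = -1).card, Finset.card_filter_le _ _, ?_⟩
  have h1 : ∀ y ∈ S, g y = 1 - 2 * (if g y = -1 then 1 else 0) := by
    intro y hy
    rcases hg y hy with h | h <;> simp [h]
  rw [Finset.sum_congr rfl h1, Finset.sum_sub_distrib, Finset.sum_const, nsmul_eq_mul, mul_one, ← Finset.mul_sum,
    Finset.sum_boole]

section e3
variable {H : Matrix ι ι ℤ} {π κ : Equiv.Perm ι} {d e : ι → ℤ}

/-- **(E3) mod p for one signed automorphism**: two distinct `π`-fixed rows of the same sign are orthogonal, and the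
part of their inner product outside the `κ`-fixed columns is divisible by `p` (`κ^(p·p) = 1`). -/
theorem fixedRows_inner_dvd (hH : IsHadamardMatrix H) (haut : IsSignedAut H π κ d e) {p : ℕ} (hp : p.Prime)
    (hκ : κ ^ (p * p) = 1) {x x' : ι} (hxx' : x ≠ x') (hx : π x = x) (hx' : π x' = x') (hdd : d x = d x') :
    (p : ℤ) ∣ ∑ y ∈ univ.filter (fun y => κ y = y), H x y * H x' y := by
  have horth : ∑ y, H x y * H x' y = 0 := hadamard_row_orth H hH hxx'
  have hsplit := Finset.sum_filter_add_sum_filter_not (univ : Finset ι) (fun y => κ y = y) (fun y => H x y * H x' y)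
  rw [horth] at hsplit
  have hinv : ∀ y, H x (κ y) * H x' (κ y) = H x y * H x' y := by
    intro y
    have h1 := haut.2.2 x y
    have h2 := haut.2.2 x' y
    rw [hx] at h1; rw [hx'] at h2
    rw [h1, h2, ← hdd]
    have hd2 : d x * d x = 1 := pm_mul_self (haut.1 x)
    have he2 : e y * e y = 1 := pm_mul_self (haut.2.1 y)
    calc d x * e y * H x y * (d x * e y * H x' y) = (d x * d x) * (e y * e y) * (H x y * H x' y) := by ring
      _ = H x y * H x' y := by rw [hd2, he2, one_mul, one_mul]
  have hmoved := dvd_sum_moved_sq κ hp hκ (fun y => H x y * H x' y) hinv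
  have e1 : (univ.filter fun y => ¬ κ y = y) = univ.filter fun y => κ y ≠ y := rfl
  rw [e1] at hsplit
  have : ∑ y ∈ univ.filter (fun y => κ y = y), H x y * H x' y = -∑ y ∈ univ.filter (fun y => κ y ≠ y), H x y * H x' y := by
    linarith
  rw [this]
  exact (dvd_neg).mpr hmoved

end e3

section order49
variable {H : Matrix ι ι ℤ}

/-- columns: `#Fix(κ) = 3` is impossible for an automorphism of pair-order `49` -/
lemma order49_cols_ten (hH : IsHadamardMatrix H) (hι : Fintype.card ι = 668)
    {π κ : Equiv.Perm ι} {d e : ι → ℤ} (haut : IsSignedAut H π κ d e)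
    (hπ : π ^ 49 = 1) (hκ : κ ^ 49 = 1) (hne : π ^ 7 ≠ 1 ∨ κ ^ 7 ≠ 1) :
    (univ.filter fun j => κ j = j).card = 10 := by
  obtain ⟨-, -, hR, hC⟩ := hadamard668_order49_structure hH hι π κ d e haut hπ hκ hne
  rcases hC with h3 | h10
  · exfalso
    -- two distinct π-fixed rows
    have h2 : 1 < (univ.filter fun i => π i = i).card := by rcases hR with h | h <;> omega
    obtain ⟨x, hx, x', hx', hxx'⟩ := Finset.one_lt_card.mp h2
    simp only [Finset.mem_filter, Finset.mem_univ, true_and] at hx hx'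
    -- a κ-fixed column gives d x = d x'
    have h0 : 0 < (univ.filter fun j => κ j = j).card := by omega
    obtain ⟨j₀, hj₀⟩ := Finset.card_pos.mp h0
    simp only [Finset.mem_filter, Finset.mem_univ, true_and] at hj₀
    have hdd : d x = d x' := by
      rw [signedAut_fixed_sign hH.1 haut hx hj₀, signedAut_fixed_sign hH.1 haut hx' hj₀]
    have hκ' : κ ^ (7 * 7) = 1 := hκ
    have hdvd := fixedRows_inner_dvd hH haut (by norm_num : (7 : ℕ).Prime) hκ' hxx' hx hx' hdd
    obtain ⟨m, hm, hsum⟩ := sum_pm_eq_card_sub_two_mul (univ.filter fun j => κ j = j) (fun y => H x y * H x' y)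
      (fun y _ => by
        rcases hH.1 x y with h1 | h1 <;> rcases hH.1 x' y with h2 | h2 <;> simp [h1, h2])
    rw [hsum, h3] at hdvd
    rw [h3] at hm
    obtain ⟨c, hc⟩ := hdvd
    push_cast at hc
    omega
  · exact h10

/-- **An automorphism of order 49 of an H(668) fixes exactly 10 rows and 10 columns** (and its 7th power exactly 80):
for a signed automorphism `(π, κ, d, e)` with `π^49 = κ^49 = 1` and `(π^7, κ^7) ≠ (1, 1)`. -/
theorem hadamard668_order49_fixed_ten (hH : IsHadamardMatrix H) (hι : Fintype.card ι = 668)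
    (π κ : Equiv.Perm ι) (d e : ι → ℤ) (haut : IsSignedAut H π κ d e)
    (hπ : π ^ 49 = 1) (hκ : κ ^ 49 = 1) (hne : π ^ 7 ≠ 1 ∨ κ ^ 7 ≠ 1) :
    (univ.filter fun i => (π ^ 7) i = i).card = 80 ∧ (univ.filter fun j => (κ ^ 7) j = j).card = 80 ∧
    (univ.filter fun i => π i = i).card = 10 ∧ (univ.filter fun j => κ j = j).card = 10 := by
  have hcard : (Fintype.card ι : ℤ) ≠ 0 := by rw [hι]; norm_num
  obtain ⟨f80R, f80C, -, -⟩ := hadamard668_order49_structure hH hι π κ d e haut hπ hκ hne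
  refine ⟨f80R, f80C, ?_, order49_cols_ten hH hι haut hπ hκ hne⟩
  exact order49_cols_ten (isHadamard_transpose hH hcard) hι (isSignedAut_transpose haut) hκ hπ hne.symm

end order49

end Summit.Ventures.DiscreteObjects.Hadamard
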